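import Summits.HodgeConjecture.HodgeConjecture.Theorems.Ring2AbelianAllSpreadFloorUnderPrimitive
import Summits.HodgeConjecture.HodgeConjecture.Theorems.Ring2AbelianAllSpreadFloorEvenPrimitive
import Summits.HodgeConjecture.HodgeConjecture.Theorems.Ring2AbelianAllAndreLiebermanDischargedRows
import HarnessLib

/-!
# Ring 2 · AbelianAll · SPREADING axis, part XVI — THE FLOOR'S COMPARISON COLUMN WITH THE LIEBERMAN AND ABDULALI
# BINDERS REMOVED: every `_of_lieberman` row of parts XII–XIII and every `_of_abdulali[A]` row of part XI restated
# with `hL`, `h₈A`, `h₈` supplied by ab-andre-2's theorems (parts XXII-c/d); `Num^CM ⟹ (L)` is now FACT-FREE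

research route, not a corollary; conditional on HC_CM plus one named minimal statement.
(Cell line: research route conditional on HC_CM; not a corollary; Q11.4-sentence-2 already refuted in dim ≥ 3.)

Seat `pub-hodge-ring2-ab-spread-1` (SPREADING), generation 26. Nothing in this file is a case of the Hodge conjecture.
`HC_CM` = `Theses.RankFourFaces.CMAbelianHodge` is a BINDER in the rows of §1 and §4 that mention it and absent elsewhere;
`HC_AV` = `Theses.PadicSemiregularLift.HodgeAbelianVarieties`; the item `Theses.RankFourFaces.CMToAbelian`
(stmt-HodgeConjecture-16267) stays OPEN. No definition, no new named fact, no sorry, no new node.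

## Why this file

Seat ab-andre-2's part XXII-c (`Ring2AbelianAllAndreLiebermanHolds`, 2026-08-21) PROVES the Literature named fact
`hL : HodgeTheory.Lieberman1968_lefschetzInvolution_algebraic_abelianVariety` (Lieberman 1968 / Kleiman 1968 2A11: `B(A)` for
every complex abelian variety, in the tree's `⋆_L`-form) as `lieberman1968_lefschetzInvolution_algebraic_abelianVariety_holds`,
and their part XXII-d (`Ring2AbelianAllAndreLiebermanDischargedRows`) derives from it ab-andre-1's two Abdulali facts
`h₈A : Abdulali1994_invariantCycles_of_lefschetzStandardA` (`abdulali1994A_holds`) and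
`h₈ : Abdulali1994_invariantCycles_of_lefschetzStandard` (`abdulali1994_holds`), and removes `hL` from THEIR rows (XVIII-e,
XXI-c). This seat's floor files display the same three binders: part XI (`…SpreadFloorUnderAndre`, the standard-conjecture rows
§B modulo `h₈A` / `h₈`), part XII (`…SpreadFloorUnderNumerical`, the numerical column modulo `hL`) and part XIII
(`…SpreadFloorUnderPrimitive`, the primitive-lift bracket modulo `hL`). This part restates each such row WITHOUT the binder —
every statement below is the earlier statement with the hypothesis `hL` / `h₈A` / `h₈` deleted, every proof is the earlier
theorem applied to ab-andre-2's `_holds` theorem BY NAME (count once: the discharge is THEIRS; the rows are this seat's).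
Parts XI–XIII are untouched (their binder-displaying rows stay true and citable).

## What is proved

* §1 (part XI §B–§C without Abdulali): `A_pen^CM / A_pen∀ / B_pen^CM / (5) / B_pen∀ ⟹ F_CM` modulo Lemme 6.3.1 ONLY
  (`hodgeFailureSpreadsToCMFibre_of_andre1996_of_{cmPointedPencilStandardA, compactAbelianPencilStandardA,
  cmPointedPencilLefschetz, lefschetzBCMPointedPencils, compactAbelianPencilLefschetz}`, table
  `spreadFloor_below_standardConjectureNodes_of_andre1996`); `HC_CM ∧ A_pen^CM ⟹ HC_AV` through the floor modulo `h₂₁` only.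
* §2 (part XII §1–§2, §5–§6 without Lieberman): **`Num^CM ⟹ (L)` FACT-FREE** (`cmFibreAlgebraicLift_of_cmPointedPencilNumerical`);
  `Num^CM / HomNum_pen^CM ⟹ F_CM` modulo `h₂₁` only; table `spreadFloor_below_numericalAxis_of_andre1996`; the B_min frontier rows
  `bminFrontier_of_andre1996_of_spread` (K[h₂₁, Spread]) and `bminFrontier_of_andre1996_of_verdier` (K[h₂₁, Verdier]).
* §3 (part XIII without Lieberman): ONE PENCIL, ANY `d`, NO binder — the primitive lift at every point of one compact abelian pencil
  `⟹ (1.1)_f` (`invariantCyclesHoldFor_of_primitiveLift`); `Num^CM ⟹ [CM primitive lift]` FACT-FREE; `[CM primitive lift] ⟹ F_CM`,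
  `[primitive lift everywhere] ⟹ F_CM` modulo `h₂₁` only; `F_CM ⟺ [primitive lift everywhere]` modulo [h₂₁, Verdier, HC_CM]
  (no `hL`); frontier row `bminFrontier_primitiveLift_of_andre1996_of_verdier`.
* §4 THE WHOLE COLUMN ON THE FACTS OF RECORD AFTER THE DISCHARGE (`spreadFloor_column_of_andre1996`): `HC_CM`-FREE and modulo
  André's Lemme 6.3.1 ALONE, `A_pen^CM ⟹ Num^CM ⟹ (L) ⟺ [CM primitive lift]`, `(L) ⟹ F_CM ⟹ F_CM^prim ⟹ F_CM^{prim,ev} ⟹ CMToAbelian`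
  (parts XIV–XV for the last three, fact-free); and UNDER `HC_CM`, modulo [h₂₁, Verdier], the column COLLAPSES
  (`spreadFloor_column_collapse_of_andre1996_of_verdier_of_HC_CM`: `F_CM ⟺ Num^CM ⟺ (L) ⟺ (L∀) ⟺ F_CM^prim ⟺ F_CM^{prim,ev}`).

## Honest status

Nothing here proves `HC_AV`, `HC_CM`, `CMToAbelian`, `(L)`, `(L∀)`, a primitive-lift shape, `Num^CM`, `A_pen`, `B_pen`, `(5)`
or `F_CM`; no arrow is reversed; no `HC_CM`-free converse is claimed. The DISCHARGES are ab-andre-2's theorems (XXII-c/d),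
called by name — this seat proves no instance of `B(A)`, `A(X, η)` or Abdulali's (1.1). What changes is the MODULUS of this
seat's comparison rows: every former K[hL, h₂₁] / K[h₈A, h₂₁] / K[h₈, h₂₁] row is now K[h₂₁]; every former K[hL, h₂₁, Verdier]
row is K[h₂₁, Verdier]; `Num^CM ⟹ (L)`, `Num^CM ⟹ [CM primitive lift]` and the one-pencil theorem of §3 are K (no binder). The
displayed named facts left in the floor files XI–XVI are André's Lemme 6.3.1 (`h₂₁`) and, for the collapse rows, the spreading
input (`hSp` = `spread_algebraicClasses_over_smoothCurve`, part XII §5) or Verdier's generic local triviality (`hGT`, part XII §6)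
— never discharged here. `B_min` of record: the least TYPED node is `F_CM^{prim,ev}` (part XV; = `F_CM` modulo `HC_CM`; least
typed so far, not a canonical floor — F-ab-96); 'minimal' is claimed for nothing (F-ab-4, F-ab-81).

## Edge labels (K[…] = kernel theorem modulo the displayed binders; formerly-bracketed fact struck)

§1 five rows K[h₂₁] (were K[h₈A, h₂₁] / K[h₈, h₂₁]); via-floor row K[h₂₁, HC_CM] · §2 `Num^CM ⟹ (L)` K (was K[hL]); four floor
rows K[h₂₁] (were K[hL, h₂₁]); frontier rows K[h₂₁, Spread] / K[h₂₁, Verdier] (were K[hL, …]) · §3 one-pencil theorem K (was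
K[hL]); `Num^CM ⟹ [CM primitive lift]` K; two floor rows K[h₂₁]; `F_CM ⟺ [primitive lift everywhere]` K[h₂₁, Verdier, HC_CM];
frontier K[h₂₁, Verdier] · §4 column K[h₂₁]; collapse K[h₂₁, Verdier, HC_CM].

References: [cite: Lieberman1968, main theorem] · [cite: Kleiman1968AlgebraicCycles, App. to §2 Thm. 2A11, §3 Thm. 3.5 and
Cor. 3.9] · [cite: Abdulali1994FamiliesAV, (1.1) (pp. 1122–1123)] · [cite: Milne2020HodgeClassesAV, Prop. 1 (p. 7)] ·
[cite: Andre1996Motifs, Lemme 6.3.1 (p. 31), §6.3 a) and Remarque 2 (p. 33)] · [cite: Verdier1976, Cor. (5.1)] ·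
[cite: VoisinHodgeII2003, §10.2.1, proof of Thm. 10.19] · [cite: BrosnanFangNiePearlstein2009, Lemma 48].
-/

set_option linter.dupNamespace false

namespace Summit.HodgeConjecture.HodgeConjecture.Ring2.AbelianAll

open CategoryTheory AlgebraicGeometry
open Literature.AlgebraicGeometry Literature.AlgebraicGeometry.Motives
open Literature.AlgebraicGeometry.HodgeTheory
open Literature.AlgebraicTopology.SingularHomology (singularCohomology cupProduct)
open Literature.AlgebraicGeometry.Deligne1982 (cmLocus)
open Literature.AlgebraicGeometry.Abdulali1994 (InvariantCyclesHoldFor)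
open Literature.AlgebraicGeometry.Andre1996 (andre1996_cmAnchoredPencil)
open Summit.HodgeConjecture.HodgeConjecture
open Summit.HodgeConjecture.HodgeConjecture.Theses
open Summit.HodgeConjecture.HodgeConjecture.Theses.RankFourFaces (CMAbelianHodge CMToAbelian)
open Summit.HodgeConjecture.HodgeConjecture.Theses.PadicSemiregularLift (HodgeAbelianVarieties)

variable {𝒳 S : SchemeOver ℂ}

/-! ## §1 Part XI's standard-conjecture rows with the Abdulali binders `h₈A`, `h₈` supplied (ab-andre-2 XXII-d) -/

/-- **A_pen^CM ⟹ F_CM modulo Lemme 6.3.1 ONLY** — part XI's `hodgeFailureSpreadsToCMFibre_of_abdulaliA_of_andre1996_of_cmPointedPencilStandardA`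
with `h₈A := abdulali1994A_holds`; equally part XII's `…_of_lieberman_of_andre1996_of_cmPointedPencilStandardA` with `hL` supplied
(the two routes `A_pen^CM ⟹ (3c) ⟹ F_CM` and `A_pen^CM ⟹ Num^CM ⟹ (L) ⟹ F_CM` give the same row). `h₂₁` BINDER.
[cite: Abdulali1994FamiliesAV, (1.1) (p. 1122)] [cite: Lieberman1968, main theorem] [cite: Andre1996Motifs, Lemme 6.3.1 (p. 31)] -/
theorem hodgeFailureSpreadsToCMFibre_of_andre1996_of_cmPointedPencilStandardA (h₂₁ : andre1996_cmAnchoredPencil)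
    (hA : CMPointedPencilStandardA) : HodgeFailureSpreadsToCMFibre :=
  hodgeFailureSpreadsToCMFibre_of_abdulaliA_of_andre1996_of_cmPointedPencilStandardA abdulali1994A_holds h₂₁ hA

/-- The same row along the numerical route (part XII §2 with Lieberman's theorem supplied) — recorded as an `example` so that the
two derivations are both kernel-checked against ONE statement. [cite: Lieberman1968, main theorem] -/
example (h₂₁ : andre1996_cmAnchoredPencil) (hA : CMPointedPencilStandardA) : HodgeFailureSpreadsToCMFibre :=
  hodgeFailureSpreadsToCMFibre_of_lieberman_of_andre1996_of_cmPointedPencilStandardA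
    lieberman1968_lefschetzInvolution_algebraic_abelianVariety_holds h₂₁ hA

/-- **A_pen∀ ⟹ F_CM modulo Lemme 6.3.1 ONLY** (part XI's row, `h₈A := abdulali1994A_holds`).
[cite: Abdulali1994FamiliesAV, (1.1) (p. 1122)] [cite: Andre1996Motifs, Lemme 6.3.1 (p. 31)] -/
theorem hodgeFailureSpreadsToCMFibre_of_andre1996_of_compactAbelianPencilStandardA (h₂₁ : andre1996_cmAnchoredPencil)
    (hA : CompactAbelianPencilStandardA) : HodgeFailureSpreadsToCMFibre :=
  hodgeFailureSpreadsToCMFibre_of_abdulaliA_of_andre1996_of_compactAbelianPencilStandardA abdulali1994A_holds h₂₁ hA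

/-- **B_pen^CM ⟹ F_CM modulo Lemme 6.3.1 ONLY** (part XI's row, `h₈ := abdulali1994_holds`).
[cite: Abdulali1994FamiliesAV, (1.1) (pp. 1122–1123)] [cite: Andre1996Motifs, Lemme 6.3.1 (p. 31) and Remarque 2 (p. 33)] -/
theorem hodgeFailureSpreadsToCMFibre_of_andre1996_of_cmPointedPencilLefschetz (h₂₁ : andre1996_cmAnchoredPencil)
    (hB : CMPointedPencilLefschetz) : HodgeFailureSpreadsToCMFibre :=
  hodgeFailureSpreadsToCMFibre_of_abdulali_of_andre1996_of_cmPointedPencilLefschetz abdulali1994_holds h₂₁ hB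

/-- **(5) ⟹ F_CM modulo Lemme 6.3.1 ONLY** (part XI's row, `h₈ := abdulali1994_holds`): the open content of (5) is `B` for the
`(2 dim A + 1)`-dimensional total spaces of CM-anchored compact abelian pencils (ab-andre-2 XXII-d §5).
[cite: Abdulali1994FamiliesAV, (1.1) (pp. 1122–1123)] [cite: Andre1996Motifs, Lemme 6.3.1 (p. 31) and Remarque 2 (p. 33)] -/
theorem hodgeFailureSpreadsToCMFibre_of_andre1996_of_lefschetzBCMPointedPencils (h₂₁ : andre1996_cmAnchoredPencil)
    (h5 : LefschetzBCMPointedPencils) : HodgeFailureSpreadsToCMFibre :=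
  hodgeFailureSpreadsToCMFibre_of_abdulali_of_andre1996_of_lefschetzBCMPointedPencils abdulali1994_holds h₂₁ h5

/-- **B_pen∀ ⟹ F_CM modulo Lemme 6.3.1 ONLY** (part XI's row, `h₈ := abdulali1994_holds`).
[cite: Abdulali1994FamiliesAV, (1.1) (pp. 1122–1123)] [cite: Andre1996Motifs, Lemme 6.3.1 (p. 31)] -/
theorem hodgeFailureSpreadsToCMFibre_of_andre1996_of_compactAbelianPencilLefschetz (h₂₁ : andre1996_cmAnchoredPencil)
    (hB : CompactAbelianPencilLefschetz) : HodgeFailureSpreadsToCMFibre :=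
  hodgeFailureSpreadsToCMFibre_of_abdulali_of_andre1996_of_compactAbelianPencilLefschetz abdulali1994_holds h₂₁ hB

/-- **THE SPREAD FLOOR LIES BELOW THE STANDARD-CONJECTURE NODES, modulo Lemme 6.3.1 ONLY** (part XI's five-row table
`spreadFloor_below_standardConjectureNodes` without `h₈A`). No converse is claimed, even under `HC_CM`.
[cite: Abdulali1994FamiliesAV, (1.1) (p. 1122)] [cite: Andre1996Motifs, Lemme 6.3.1 and Remarque 2 (pp. 31–33)] -/
theorem spreadFloor_below_standardConjectureNodes_of_andre1996 (h₂₁ : andre1996_cmAnchoredPencil) :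
    (CMPointedPencilStandardA → HodgeFailureSpreadsToCMFibre) ∧ (CompactAbelianPencilStandardA → HodgeFailureSpreadsToCMFibre) ∧
      (CMPointedPencilLefschetz → HodgeFailureSpreadsToCMFibre) ∧ (LefschetzBCMPointedPencils → HodgeFailureSpreadsToCMFibre) ∧
      (CompactAbelianPencilLefschetz → HodgeFailureSpreadsToCMFibre) :=
  spreadFloor_below_standardConjectureNodes abdulali1994A_holds h₂₁

/-- **Under `HC_CM` (binder), A_pen^CM gives `HC_AV` THROUGH the floor, modulo `h₂₁` only** (part XI's
`HC_AV_of_HC_CM_of_abdulaliA_of_andre1996_of_cmPointedPencilStandardA_via_floor` without `h₈A`; the same conclusion as ab-andre-2's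
direct row `HC_AV_of_HC_CM_of_cmPointedPencilStandardA`). research route, not a corollary; conditional on HC_CM plus one named
minimal statement. [cite: Andre1996Motifs, Lemme 6.3.1 (p. 31)] [cite: Abdulali1994FamiliesAV, (1.1) (p. 1122)] -/
theorem HC_AV_of_HC_CM_of_andre1996_of_cmPointedPencilStandardA_via_floor (h₂₁ : andre1996_cmAnchoredPencil)
    (hCM : CMAbelianHodge) (hA : CMPointedPencilStandardA) : HodgeAbelianVarieties :=
  HC_AV_of_HC_CM_and_hodgeFailureSpreadsToCMFibre hCM (hodgeFailureSpreadsToCMFibre_of_andre1996_of_cmPointedPencilStandardA h₂₁ hA)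

/-! ## §2 Part XII's numerical column with Lieberman's theorem supplied (ab-andre-2 XXII-c) -/

/-- **`Num^CM ⟹ (L)` with NO binder** — part XII §1 `cmFibreAlgebraicLift_of_lieberman_of_cmPointedPencilNumerical` with `hL`
supplied: Grothendieck's `D` for the CM-fibre-supported cycles of the total spaces gives the fibre-class lift at the CM points,
the perfect pairings (Perf_t) on the fibres being ab-andre-2's unconditional `nondegenerate_fiberOver` (XXII-d). `HC_CM` does
not occur; no named fact occurs. [cite: Lieberman1968, main theorem] [cite: Kleiman1968AlgebraicCycles, §3 Cor. 3.9]
[cite: Milne2020HodgeClassesAV, Prop. 1 (p. 7)] -/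
theorem cmFibreAlgebraicLift_of_cmPointedPencilNumerical (hNum : CMPointedPencilNumerical) : CMFibreAlgebraicLift :=
  cmFibreAlgebraicLift_of_lieberman_of_cmPointedPencilNumerical lieberman1968_lefschetzInvolution_algebraic_abelianVariety_holds
    hNum

/-- **Num^CM ⟹ F_CM modulo Lemme 6.3.1 ONLY** (§2's lift, then part XI's `(L) ⟹[h₂₁] F_CM`).
[cite: Andre1996Motifs, Lemme 6.3.1 (p. 31)] [cite: Lieberman1968, main theorem] -/
theorem hodgeFailureSpreadsToCMFibre_of_andre1996_of_cmPointedPencilNumerical (h₂₁ : andre1996_cmAnchoredPencil)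
    (hNum : CMPointedPencilNumerical) : HodgeFailureSpreadsToCMFibre :=
  hodgeFailureSpreadsToCMFibre_of_andre1996_of_cmFibreAlgebraicLift h₂₁ (cmFibreAlgebraicLift_of_cmPointedPencilNumerical hNum)

/-- **HomNum_pen^CM ⟹ F_CM modulo Lemme 6.3.1 ONLY**: ab-andre-1's displayed hypothesis "hom ≡ num ⊗ ℂ on the CM-pointed total
spaces" (part XIV-d `cmPointedPencilStandardA_of_homNum`, Kleiman `D ⇒ A`), verbatim, lies above the floor with no other fact
(part XII's row without `hL`). [cite: Kleiman1968AlgebraicCycles, §3 Thm. 3.5] [cite: Andre1996Motifs, Lemme 6.3.1 (ii) (p. 31)] -/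
theorem hodgeFailureSpreadsToCMFibre_of_andre1996_of_homNumCMPointed (h₂₁ : andre1996_cmAnchoredPencil)
    (hD : ∀ ⦃d : ℕ⦄ ⦃𝒳 S : SchemeOver ℂ⦄ (f : 𝒳 ⟶ S), IsCompactAbelianPencil f d → (cmLocus f d).Nonempty →
      ∀ (p q : ℕ) (hpq : p + q = d + 1) (_ : 2 ≤ p) (_ : p < q), ∀ y ∈ algebraicClasses 𝒳 q,
        (∀ x ∈ algebraicClasses 𝒳 p, cupProduct (show 2 * p + 2 * q = 2 * (d + 1) by omega) x y = 0) → y = 0) :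
    HodgeFailureSpreadsToCMFibre :=
  hodgeFailureSpreadsToCMFibre_of_lieberman_of_andre1996_of_homNumCMPointed
    lieberman1968_lefschetzInvolution_algebraic_abelianVariety_holds h₂₁ hD

/-- **The numerical / Lefschetz-`A` column lies above the floor modulo Lemme 6.3.1 ONLY** (part XII's four-row table
`spreadFloor_below_numericalAxis` without `hL`). 'Smaller' = below in the preorder of landed kernel edges modulo the displayed
fact; 'minimal' is claimed for nothing. [cite: Andre1996Motifs, Lemme 6.3.1 (p. 31)] [cite: Lieberman1968, main theorem] -/
theorem spreadFloor_below_numericalAxis_of_andre1996 (h₂₁ : andre1996_cmAnchoredPencil) :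
    (CMPointedPencilNumerical → HodgeFailureSpreadsToCMFibre) ∧ (CMFibreAlgebraicLift → HodgeFailureSpreadsToCMFibre) ∧
      (CMPointedPencilStandardA → HodgeFailureSpreadsToCMFibre) ∧
      (CompactAbelianPencilStandardA → HodgeFailureSpreadsToCMFibre) :=
  spreadFloor_below_numericalAxis lieberman1968_lefschetzInvolution_algebraic_abelianVariety_holds h₂₁

/-- **THE B_min FRONTIER {F_CM, Num^CM}, spreading-keyed, WITHOUT Lieberman**: `HC_CM`-FREE it is ORDERED — `Num^CM ⟹ F_CM`
modulo `h₂₁` — and UNDER `HC_CM` it COLLAPSES — `F_CM ⟺ Num^CM` modulo [h₂₁, Spread] (part XII §5). No `HC_CM`-free converse is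
claimed; 'minimal' claimed for nothing. `h₂₁`, `hSp` BINDERS (named facts); `HC_CM` a binder inside the second conjunct.
research route, not a corollary; conditional on HC_CM plus one named minimal statement.
[cite: Andre1996Motifs, Lemme 6.3.1 (p. 31) and §6.3 (p. 33)] [cite: VoisinHodgeII2003, §10.2.1, proof of Thm. 10.19] -/
theorem bminFrontier_of_andre1996_of_spread (h₂₁ : andre1996_cmAnchoredPencil)
    (hSp : spread_algebraicClasses_over_smoothCurve) :
    (CMPointedPencilNumerical → HodgeFailureSpreadsToCMFibre) ∧
      (CMAbelianHodge → (HodgeFailureSpreadsToCMFibre ↔ CMPointedPencilNumerical)) :=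
  bminFrontier_of_lieberman_of_andre1996_of_spread lieberman1968_lefschetzInvolution_algebraic_abelianVariety_holds h₂₁ hSp

/-- **THE B_min FRONTIER {F_CM, Num^CM} ON THE AXIS'S FACTS OF RECORD AFTER THE DISCHARGE, {h₂₁, Verdier}**: `HC_CM`-FREE
ORDERED modulo `h₂₁`, COLLAPSED under `HC_CM` modulo [h₂₁, Verdier] (part XII §6 without `hL`). `h₂₁`, `hGT` BINDERS.
[cite: Andre1996Motifs, Lemme 6.3.1 (p. 31) and §6.3 (p. 33)] [cite: Verdier1976, Thm. (4.14) and Cor. (5.1)] -/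
theorem bminFrontier_of_andre1996_of_verdier (h₂₁ : andre1996_cmAnchoredPencil) (hGT : Verdier1976_genericLocalTriviality) :
    (CMPointedPencilNumerical → HodgeFailureSpreadsToCMFibre) ∧
      (CMAbelianHodge → (HodgeFailureSpreadsToCMFibre ↔ CMPointedPencilNumerical)) :=
  bminFrontier_of_lieberman_of_andre1996_of_verdier lieberman1968_lefschetzInvolution_algebraic_abelianVariety_holds h₂₁ hGT

/-! ## §3 Part XIII's primitive-lift bracket with Lieberman's theorem supplied -/

/-- Display-only shape (no `def`; copied verbatim from ab-andre-2's parts XXI-b/c and XXII-d, and part XIII): the CM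
PRIMITIVE LIFT. -/
local notation3 (prettyPrint := false) "CMPrimitiveLift[]" =>
  ∀ ⦃d : ℕ⦄ ⦃𝒳 S : SchemeOver ℂ⦄ (f : 𝒳 ⟶ S) (_ : IsCompactAbelianPencil f d) (t : ComplexPoints S),
    t ∈ cmLocus f d → ∀ (K : complexBetti 𝒳 2), K ∈ algebraicClasses 𝒳 1 →
    (∀ s : ComplexPoints S, IsPolarizationClass d (fiberOver f s) (complexBetti.map (fiberι f s) 2 K)) →
    ∀ r, 2 ≤ r → 2 * r ≤ d → ∀ ξ ∈ algebraicClasses (fiberOver f t) r,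
      ξ ∈ primitiveClasses (complexBetti.map (fiberι f t) 2 K) d (2 * r) →
      ξ ∈ LinearMap.range (complexBetti.map (fiberι f t) (2 * r)).hom →
      ξ ∈ (algebraicClasses 𝒳 r).map (complexBetti.map (fiberι f t) (2 * r)).hom

/-- Display-only shape (no `def`; copied verbatim from ab-andre-2's parts XXI-c / XXII-d and part XIII): the PRIMITIVE LIFT
AT EVERY POINT of every compact pencil of abelian varieties. -/
local notation3 (prettyPrint := false) "PrimitiveLiftEverywhere[]" =>
  ∀ ⦃d : ℕ⦄ ⦃𝒳 S : SchemeOver ℂ⦄ (f : 𝒳 ⟶ S) (_ : IsCompactAbelianPencil f d) (t : ComplexPoints S)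
    (K : complexBetti 𝒳 2), K ∈ algebraicClasses 𝒳 1 →
    (∀ s : ComplexPoints S, IsPolarizationClass d (fiberOver f s) (complexBetti.map (fiberι f s) 2 K)) →
    ∀ r, 2 ≤ r → 2 * r ≤ d → ∀ ξ ∈ algebraicClasses (fiberOver f t) r,
      ξ ∈ primitiveClasses (complexBetti.map (fiberι f t) 2 K) d (2 * r) →
      ξ ∈ LinearMap.range (complexBetti.map (fiberι f t) (2 * r)).hom →
      ξ ∈ (algebraicClasses 𝒳 r).map (complexBetti.map (fiberι f t) (2 * r)).hom

/-- **ONE PENCIL, ANY `d`, NO BINDER: the primitive lift at every point of ONE compact pencil of abelian `d`-folds `⟹ (1.1)_f`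
for that pencil** (part XIII §1 `invariantCyclesHoldFor_of_lieberman_of_primitiveLift` with `hL` supplied; ab-andre-2's node row
`compactAbelianPencilVHC_of_primitiveLiftEverywhere` (XXII-d) quantifies over all pencils). `K ∈ C¹(𝒳)` is any global algebraic
class polarising every fibre. [cite: Abdulali1994FamiliesAV, (1.1) (p. 1122)] [cite: Lieberman1968, main theorem]
[cite: Milne2020HodgeClassesAV, Prop. 1 (p. 7)] -/
theorem invariantCyclesHoldFor_of_primitiveLift {d : ℕ} {f : 𝒳 ⟶ S} (hf : IsCompactAbelianPencil f d)
    {K : complexBetti 𝒳 2} (hKalg : K ∈ algebraicClasses 𝒳 1)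
    (hKs : ∀ s : ComplexPoints S, IsPolarizationClass d (fiberOver f s) (complexBetti.map (fiberι f s) 2 K))
    (hPrim : ∀ (s : ComplexPoints S) (r : ℕ), 2 ≤ r → 2 * r ≤ d → ∀ ξ ∈ algebraicClasses (fiberOver f s) r,
      ξ ∈ primitiveClasses (complexBetti.map (fiberι f s) 2 K) d (2 * r) →
      ξ ∈ LinearMap.range (complexBetti.map (fiberι f s) (2 * r)).hom →
      ξ ∈ (algebraicClasses 𝒳 r).map (complexBetti.map (fiberι f s) (2 * r)).hom) :
    InvariantCyclesHoldFor f d :=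
  invariantCyclesHoldFor_of_lieberman_of_primitiveLift lieberman1968_lefschetzInvolution_algebraic_abelianVariety_holds
    hf hKalg hKs hPrim

/-- **`Num^CM ⟹ [CM primitive lift]` with NO binder** (part XIII §2 without `hL`; equally §2's fact-free lift followed by
ab-andre-2's fact-free `(L) ⟹ [CM primitive lift]`, XXI-b). The converse is NOT claimed without `HC_CM`.
[cite: Kleiman1968AlgebraicCycles, §3 Cor. 3.9] [cite: Lieberman1968, main theorem] -/
theorem cmPrimitiveLift_of_cmPointedPencilNumerical (hNum : CMPointedPencilNumerical) : CMPrimitiveLift[] :=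
  cmPrimitiveLift_of_cmFibreAlgebraicLift (cmFibreAlgebraicLift_of_cmPointedPencilNumerical hNum)

/-- **`h₂₁ → [CM primitive lift] → F_CM`, no `HC_CM`, no other fact** (part XIII §3 without `hL`: ab-andre-2's binder-free
`(L) ⟺ [CM primitive lift]` (XXII-d), then part XI's `(L) ⟹[h₂₁] F_CM`). `h₂₁` BINDER.
[cite: Andre1996Motifs, Lemme 6.3.1 (p. 31) and §6.3 a) (p. 33)] [cite: Lieberman1968, main theorem] -/
theorem hodgeFailureSpreadsToCMFibre_of_andre1996_of_cmPrimitiveLift (h₂₁ : andre1996_cmAnchoredPencil)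
    (hPrim : CMPrimitiveLift[]) : HodgeFailureSpreadsToCMFibre :=
  hodgeFailureSpreadsToCMFibre_of_andre1996_of_cmFibreAlgebraicLift h₂₁ (cmFibreAlgebraicLift_iff_cmPrimitiveLift.2 hPrim)

/-- **`h₂₁ → [primitive lift at every point] → F_CM`, no `HC_CM`, no other fact** (part XIII §3 without `hL`: XXII-d's
binder-free `(L∀) ⟺ [primitive lift everywhere]`, then part XI's `(L∀) ⟹[h₂₁] F_CM`). `h₂₁` BINDER.
[cite: Andre1996Motifs, Lemme 6.3.1 (p. 31) and Remarque 2 (p. 33)] [cite: Lieberman1968, main theorem] -/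
theorem hodgeFailureSpreadsToCMFibre_of_andre1996_of_primitiveLiftEverywhere (h₂₁ : andre1996_cmAnchoredPencil)
    (hPrim : PrimitiveLiftEverywhere[]) : HodgeFailureSpreadsToCMFibre :=
  hodgeFailureSpreadsToCMFibre_of_andre1996_of_algebraicFixedPart h₂₁ (algebraicFixedPart_iff_primitiveLiftEverywhere.2 hPrim)

/-- **The `HC_CM`-free primitive column under the floor in one row, modulo Lemme 6.3.1 ONLY** (part XIII's
`spreadFloor_below_primitiveLift` without `hL`): `(Num^CM ⟹ [CM primitive lift]) ∧ ([CM primitive lift] ⟹ F_CM) ∧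
([primitive lift everywhere] ⟹ [CM primitive lift])`. No converse claimed. [cite: Andre1996Motifs, §6.3 (p. 33)]
[cite: Lieberman1968, main theorem] -/
theorem spreadFloor_below_primitiveLift_of_andre1996 (h₂₁ : andre1996_cmAnchoredPencil) :
    (CMPointedPencilNumerical → CMPrimitiveLift[]) ∧ (CMPrimitiveLift[] → HodgeFailureSpreadsToCMFibre) ∧
      (PrimitiveLiftEverywhere[] → CMPrimitiveLift[]) :=
  spreadFloor_below_primitiveLift lieberman1968_lefschetzInvolution_algebraic_abelianVariety_holds h₂₁

/-- **Under the binders `h₂₁`, Verdier 1976 and `HC_CM` (no `hL`): `F_CM ⟺ [primitive lift at every point]`** (part VII's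
fact-free `ExactWithCM F_CM` against ab-andre-2's XXII-d `HC_AV_iff_HC_CM_and_primitiveLiftEverywhere_of_verdier`, combined by the
Frame's `iff_of_exactWithCM_of_HC_CM`; part XIII's row carried `hL`). [cite: Verdier1976, Cor. (5.1)]
[cite: Andre1996Motifs, Lemme 6.3.1 (p. 31) and Remarque 2 (p. 33)] [cite: Lieberman1968, main theorem] -/
theorem hodgeFailureSpreadsToCMFibre_iff_primitiveLiftEverywhere_of_andre1996_of_verdier_of_HC_CM
    (h₂₁ : andre1996_cmAnchoredPencil) (hGT : Verdier1976_genericLocalTriviality) (hCM : CMAbelianHodge) :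
    HodgeFailureSpreadsToCMFibre ↔ PrimitiveLiftEverywhere[] :=
  iff_of_exactWithCM_of_HC_CM exactWithCM_hodgeFailureSpreadsToCMFibre
    (HC_AV_iff_HC_CM_and_primitiveLiftEverywhere_of_verdier h₂₁ hGT) hCM

/-- **THE PRIMITIVE-LIFT BRACKET AGAINST THE B_min FRONTIER ON THE FACTS OF RECORD AFTER THE DISCHARGE, {h₂₁, Verdier}**:
`HC_CM`-FREE the column is ORDERED — `Num^CM ⟹ [CM primitive lift]` (no binder), `[CM primitive lift] ⟹ F_CM` modulo `h₂₁` —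
and UNDER `HC_CM` it COLLAPSES — `F_CM ⟺ [CM primitive lift]` modulo [h₂₁, Verdier] (part XIII §4, unchanged). No `HC_CM`-free
converse claimed; 'minimal' claimed for nothing. `h₂₁`, `hGT` BINDERS; `HC_CM` a binder inside the third conjunct.
research route, not a corollary; conditional on HC_CM plus one named minimal statement.
[cite: Andre1996Motifs, Lemme 6.3.1 (p. 31) and §6.3 (p. 33)] [cite: Verdier1976, Cor. (5.1)] [cite: Lieberman1968, main theorem] -/
theorem bminFrontier_primitiveLift_of_andre1996_of_verdier (h₂₁ : andre1996_cmAnchoredPencil)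
    (hGT : Verdier1976_genericLocalTriviality) :
    (CMPointedPencilNumerical → CMPrimitiveLift[]) ∧ (CMPrimitiveLift[] → HodgeFailureSpreadsToCMFibre) ∧
      (CMAbelianHodge → (HodgeFailureSpreadsToCMFibre ↔ CMPrimitiveLift[])) :=
  bminFrontier_primitiveLift_of_lieberman_of_andre1996_of_verdier
    lieberman1968_lefschetzInvolution_algebraic_abelianVariety_holds h₂₁ hGT

/-! ## §4 The whole floor column on the facts of record after the discharge -/

/-- **THE SPREAD FLOOR'S COMPARISON COLUMN, `HC_CM`-FREE, MODULO ANDRÉ'S LEMME 6.3.1 ALONE** (the only displayed named fact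
left): `A_pen^CM ⟹ Num^CM` (ab-andre-2 XVIII-e, fact-free), `Num^CM ⟹ (L)` (§2, fact-free), `(L) ⟺ [CM primitive lift]`
(ab-andre-2 XXII-d, fact-free), `(L) ⟹[h₂₁] F_CM` (part XI), `F_CM ⟹ F_CM^prim ⟹ F_CM^{prim,ev} ⟹ CMToAbelian` (parts XIV–XV,
fact-free). Every arrow one-way as typed; no converse is claimed `HC_CM`-free; nothing closes the item (stmt-HodgeConjecture-16267
OPEN). The least TYPED node is `F_CM^{prim,ev}` (least typed so far, not a canonical floor — F-ab-96); 'minimal' claimed for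
nothing. [cite: Kleiman1968AlgebraicCycles, §3 Cor. 3.9] [cite: Lieberman1968, main theorem]
[cite: Andre1996Motifs, Lemme 6.3.1 (p. 31)] [cite: BrosnanFangNiePearlstein2009, Lemma 48] -/
theorem spreadFloor_column_of_andre1996 (h₂₁ : andre1996_cmAnchoredPencil) :
    (CMPointedPencilStandardA → CMPointedPencilNumerical) ∧ (CMPointedPencilNumerical → CMFibreAlgebraicLift) ∧
      (CMFibreAlgebraicLift ↔ CMPrimitiveLift[]) ∧ (CMFibreAlgebraicLift → HodgeFailureSpreadsToCMFibre) ∧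
      (HodgeFailureSpreadsToCMFibre → PrimitiveHodgeFailureSpreadsToCMFibre) ∧
      (PrimitiveHodgeFailureSpreadsToCMFibre → EvenPrimitiveHodgeFailureSpreadsToCMFibre) ∧
      (EvenPrimitiveHodgeFailureSpreadsToCMFibre → CMToAbelian) :=
  ⟨cmPointedPencilNumerical_of_cmPointedPencilStandardA, cmFibreAlgebraicLift_of_cmPointedPencilNumerical,
    cmFibreAlgebraicLift_iff_cmPrimitiveLift, hodgeFailureSpreadsToCMFibre_of_andre1996_of_cmFibreAlgebraicLift h₂₁,
    primitiveHodgeFailureSpreadsToCMFibre_of_hodgeFailureSpreadsToCMFibre,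
    evenPrimitiveHodgeFailureSpreadsToCMFibre_of_primitiveHodgeFailureSpreadsToCMFibre,
    cmToAbelian_of_evenPrimitiveHodgeFailureSpreadsToCMFibre⟩

/-- **UNDER `HC_CM`, MODULO [h₂₁, Verdier], THE COLUMN COLLAPSES**: `F_CM ⟺ Num^CM ⟺ (L) ⟺ (L∀)` (part XII §6, by name) and
`F_CM ⟺ F_CM^prim ⟺ F_CM^{prim,ev}` (parts XIV–XV, fact-free under `HC_CM`) — every node of the column is then `⟺ HC_AV`.
`h₂₁`, `hGT`, `HC_CM` BINDERS. research route, not a corollary; conditional on HC_CM plus one named minimal statement.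
[cite: Andre1996Motifs, Lemme 6.3.1 and Remarque 2 (pp. 31–33)] [cite: Verdier1976, Cor. (5.1)] -/
theorem spreadFloor_column_collapse_of_andre1996_of_verdier_of_HC_CM (h₂₁ : andre1996_cmAnchoredPencil)
    (hGT : Verdier1976_genericLocalTriviality) (hCM : CMAbelianHodge) :
    (HodgeFailureSpreadsToCMFibre ↔ CMPointedPencilNumerical) ∧ (HodgeFailureSpreadsToCMFibre ↔ CMFibreAlgebraicLift) ∧
      (HodgeFailureSpreadsToCMFibre ↔ AlgebraicFixedPart) ∧
      (HodgeFailureSpreadsToCMFibre ↔ PrimitiveHodgeFailureSpreadsToCMFibre) ∧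
      (HodgeFailureSpreadsToCMFibre ↔ EvenPrimitiveHodgeFailureSpreadsToCMFibre) :=
  have h := floor_iff_liftNodes_of_andre1996_of_verdier_of_HC_CM h₂₁ hGT hCM
  ⟨h.1, h.2.1, h.2.2, (primitiveHodgeFailureSpreadsToCMFibre_iff_hodgeFailureSpreadsToCMFibre_of_HC_CM hCM).symm,
    (evenPrimitiveHodgeFailureSpreadsToCMFibre_iff_of_HC_CM hCM).2.symm⟩

end Summit.HodgeConjecture.HodgeConjecture.Ring2.AbelianAll
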